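import Literature.Analysis.SpecialFunctions.GegenbauerZonalPositivity
import Literature.Analysis.SpecialFunctions.GegenbauerOrthogonality
import Mathlib.Analysis.InnerProductSpace.PiL2
import HarnessLib

/-!
# The linear programming (Delsarte–Goethals–Seidel / Kabatiansky–Levenshtein) bound for spherical codes

A finite set `C ⊂ S^{n-1}` of unit vectors is a *spherical code with maximal cosine `s`* if
`⟨x, y⟩ ≤ s` for all distinct `x, y ∈ C`; `A(n, s)` denotes the largest cardinality of such a
code, and `A(n, 1/2)` is the kissing number of dimension `n`.

**Theorem (linear programming bound; Delsarte–Goethals–Seidel 1977, Kabatiansky–Levenshtein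
1978; Boumova 2002, Thm. 2.3.2).** Let `n ≥ 3`, `μ = (n-2)/2`, and let
`f(t) = Σ_{k=0}^{d} f_k C_k^{μ}(t)` be a real polynomial written in the Gegenbauer polynomials
`C_k^{μ}` of the sphere `S^{n-1}` (generating function `(1 - 2tr + r²)^{-μ} = Σ_k C_k^{μ}(t) r^k`;
in the tree `C_k^{μ}(t) = gegenbauerSum μ k t`, `Literature.Analysis.SpecialFunctions`), with
(A1) `f(t) ≤ 0` for `-1 ≤ t ≤ s` and (A2) `f_k ≥ 0` for all `k` (and `f_0 > 0`). Then every
spherical code `C ⊂ S^{n-1}` with maximal cosine `s` satisfies `|C| f_0 ≤ f(1)`, i.e.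
`A(n, s) ≤ f(1)/f_0`.

*Proof (the "main identity", Boumova Thm. 2.3.1).* Put `S = Σ_{x,y ∈ C} f(⟨x,y⟩)`. Splitting off
the diagonal, `S = |C| f(1) + Σ_{x ≠ y} f(⟨x,y⟩) ≤ |C| f(1)` by (A1). Expanding in the Gegenbauer
basis, `S = Σ_k f_k Σ_{x,y} C_k^{μ}(⟨x,y⟩) ≥ f_0 |C|²`, because `C_0 = 1` and each kernel
`C_k^{μ}(⟨x,y⟩)` is positive semidefinite on the sphere (Schoenberg; in the tree
`Literature.Analysis.SpecialFunctions.sum_mul_gegenbauerHom_nonneg`, proved through the Fischer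
pairing). Hence `f_0 |C|² ≤ |C| f(1)`.

What is here: the bound in coordinates (`DelsarteLP.card_mul_le_coord`, points `Fin n → ℝ` with
`Σ x_k² = 1`), for `Finset`s of `EuclideanSpace ℝ (Fin n)` (`DelsarteLP.card_mul_le`), and the
integer form `|C| ≤ N` from `f(1) < (N+1) f_0` (`DelsarteLP.card_le`); two private elementary
facts (`C_k^{μ}(1) > 0`, `⟨x,y⟩ ≥ -1`); and the case of equality (complementary slackness,
Bannai–Sloane 1981 / Conway–Sloane Ch. 14: if `|C| f_0 = f(1)` then `f(⟨x,y⟩) = 0` for all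
distinct `x, y ∈ C`: `DelsarteLP.sum_eq_zero_of_card_mul_eq(_coord)`). No new definitions: the Gegenbauer polynomials are
`gegenbauerSum` (explicit sum; `gegenbauerSum_eq_gegenbauerHom`, `gegenbauerSum_rec`).
Not here: the designs half of the theory (Boumova Thm. 2.3.3), Levenshtein's universal bound,
optimality of particular polynomials, and the dimension `n = 2` (`μ = 0`, Chebyshev case).

## References
* P. Delsarte, J. M. Goethals, J. J. Seidel, *Spherical codes and designs*, Geom. Dedicata 6
  (1977) 363–388, §4. [`DelsarteGoethalsSeidel1977`]
* G. A. Kabatiansky, V. I. Levenshtein, *Bounds for packings on a sphere and in space*, Probl.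
  Inf. Transm. 14 (1978) 1–17. [`KabatianskyLevenshtein1978`]
* S. Boumova, *Applications of polynomials to spherical codes and designs*, PhD thesis, TU
  Eindhoven 2002, Thm. 2.3.1 (main identity), Thm. 2.3.2 (LPB for spherical codes). [`Boumova2002`]
* J. H. Conway, N. J. A. Sloane, *Sphere Packings, Lattices and Groups*, 3rd ed., Ch. 9 §3 and
  Ch. 13. [`ConwaySloane1999`]
-/

noncomputable section

open Finset
open scoped RealInnerProductSpace

namespace Literature.Geometry.DiscreteGeometry

namespace DelsarteLP

open Literature.Analysis.SpecialFunctions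

variable {n : ℕ} {μ : ℝ}

/-- Two unit vectors (in coordinates, `Σ x_k² = Σ y_k² = 1`) have `Σ x_k y_k ≥ -1`
(from `Σ (x_k + y_k)² ≥ 0`). [folklore] -/
private theorem neg_one_le_dot (x y : Fin n → ℝ) (hx : ∑ k, x k ^ 2 = 1) (hy : ∑ k, y k ^ 2 = 1) :
    -1 ≤ ∑ k, x k * y k := by
  have h : 0 ≤ ∑ k, (x k + y k) ^ 2 := Finset.sum_nonneg fun k _ => sq_nonneg _
  have hx' : ∑ k, (x k + y k) ^ 2 = ∑ k, x k ^ 2 + ∑ k, y k ^ 2 + 2 * ∑ k, x k * y k := by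
    rw [Finset.mul_sum, ← Finset.sum_add_distrib, ← Finset.sum_add_distrib]
    exact Finset.sum_congr rfl fun k _ => by ring
  rw [hx', hx, hy] at h
  linarith

/-- `C_k^{μ}(1) > 0` for `μ > 0` (indeed `C_k^{μ}(1) = (2μ)_k / k!`), from the recurrence
`(k+1) C_{k+1}(1) = (k + 2μ) C_k(1)`. [folklore] -/
private theorem gegenbauerSum_one_pos (hμ : 0 < μ) (k : ℕ) : 0 < gegenbauerSum μ k 1 := by
  induction k with
  | zero => simp
  | succ k ih =>
    have h := gegenbauerSum_at_one_rec μ k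
    have hk : (0 : ℝ) ≤ (k : ℝ) + 1 := by positivity
    have hk2 : (0 : ℝ) < (k : ℝ) + 2 * μ := by positivity
    have hprod : 0 < ((k : ℝ) + 1) * gegenbauerSum μ (k + 1) 1 := by
      rw [h]; exact mul_pos hk2 ih
    exact pos_of_mul_pos_right hprod hk

/-- **Schoenberg positivity on the unit sphere, univariate form**: for unit vectors
`x_a ∈ S^{n-1}` (`n = 2μ + 2`, `μ > 0`) and every degree `k`,
`Σ_{a,b} C_k^{μ}(⟨x_a, x_b⟩) ≥ 0`. Specialisation of
`Literature.Analysis.SpecialFunctions.sum_mul_gegenbauerHom_nonneg` (all weights `1`,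
`‖x_a‖ = 1`). [cite: Boumova2002, Thm. 2.3.1 (proof: the addition formula)] -/
theorem sum_sum_gegenbauerSum_nonneg (hn : (n : ℝ) = 2 * μ + 2) (hμ : 0 < μ) (k : ℕ)
    {ι : Type*} [Fintype ι] (x : ι → Fin n → ℝ) (hunit : ∀ a, ∑ j, x a j ^ 2 = 1) :
    0 ≤ ∑ a, ∑ b, gegenbauerSum μ k (∑ j, x a j * x b j) := by
  have hpos := sum_mul_gegenbauerHom_nonneg hn hμ k x (fun _ => (1 : ℝ))
  simp only [hunit, one_mul, mul_one] at hpos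
  simpa only [gegenbauerSum_eq_gegenbauerHom] using hpos

/-- **The linear programming bound, coordinate form.** `n = 2μ + 2`, `μ > 0`; `f_k ≥ 0`;
`f(t) = Σ_{k ≤ d} f_k C_k^{μ}(t) ≤ 0` on `[-1, s]`; points `x_a : Fin n → ℝ` with `Σ_j x_{a,j}² = 1`
and `Σ_j x_{a,j} x_{b,j} ≤ s` for `a ≠ b`. Then `(#points) · f_0 ≤ f(1)`.
[cite: Boumova2002, Thm. 2.3.2 (LPB for spherical codes; DGS 1977, KL 1978)] -/
theorem card_mul_le_coord (hn : (n : ℝ) = 2 * μ + 2) (hμ : 0 < μ)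
    (d : ℕ) (f : ℕ → ℝ) (hf : ∀ k, 0 ≤ f k) (s : ℝ)
    (hF : ∀ t : ℝ, -1 ≤ t → t ≤ s → ∑ k ∈ range (d + 1), f k * gegenbauerSum μ k t ≤ 0)
    {ι : Type*} [Fintype ι] (x : ι → Fin n → ℝ)
    (hunit : ∀ a, ∑ j, x a j ^ 2 = 1) (hsep : ∀ a b, a ≠ b → ∑ j, x a j * x b j ≤ s) :
    (Fintype.card ι : ℝ) * f 0 ≤ ∑ k ∈ range (d + 1), f k * gegenbauerSum μ k 1 := by
  classical
  set F : ℝ → ℝ := fun t => ∑ k ∈ range (d + 1), f k * gegenbauerSum μ k t with hFdef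
  set ip : ι → ι → ℝ := fun a b => ∑ j, x a j * x b j with hip
  have hdiag : ∀ a, ip a a = 1 := fun a => by
    simp only [hip, ← sq]; exact hunit a
  -- lower bound `|C|² f₀ ≤ S`
  have hlow : (Fintype.card ι : ℝ) ^ 2 * f 0 ≤ ∑ a, ∑ b, F (ip a b) := by
    have hswap : ∑ a, ∑ b, F (ip a b) =
        ∑ k ∈ range (d + 1), f k * ∑ a, ∑ b, gegenbauerSum μ k (ip a b) := by
      have h1 : ∀ a, ∑ b, F (ip a b) =
          ∑ k ∈ range (d + 1), ∑ b, f k * gegenbauerSum μ k (ip a b) := fun a => by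
        simp only [hFdef]; exact Finset.sum_comm
      rw [Finset.sum_congr rfl fun a _ => h1 a, Finset.sum_comm]
      refine Finset.sum_congr rfl fun k _ => ?_
      rw [Finset.mul_sum]
      exact Finset.sum_congr rfl fun a _ => by rw [Finset.mul_sum]
    rw [hswap]
    have hterm : ∀ k ∈ range (d + 1), 0 ≤ f k * ∑ a, ∑ b, gegenbauerSum μ k (ip a b) :=
      fun k _ => mul_nonneg (hf k) (sum_sum_gegenbauerSum_nonneg hn hμ k x hunit)
    have h0 : f 0 * ∑ a, ∑ b, gegenbauerSum μ 0 (ip a b) = (Fintype.card ι : ℝ) ^ 2 * f 0 := by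
      simp only [gegenbauerSum_zero, Finset.sum_const, Finset.card_univ, nsmul_eq_mul]
      ring
    rw [← h0]
    exact Finset.single_le_sum hterm (Finset.mem_range.2 (Nat.succ_pos d))
  -- upper bound `S ≤ |C| f(1)`
  have hupp : ∑ a, ∑ b, F (ip a b) ≤ (Fintype.card ι : ℝ) * F 1 := by
    have hrow : ∀ a, ∑ b, F (ip a b) ≤ F 1 := fun a => by
      rw [← Finset.add_sum_erase _ _ (Finset.mem_univ a), hdiag]
      have hoff : ∑ b ∈ univ.erase a, F (ip a b) ≤ 0 := Finset.sum_nonpos fun b hb => by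
        have hba : b ≠ a := Finset.ne_of_mem_erase hb
        exact hF _ (neg_one_le_dot _ _ (hunit a) (hunit b)) (hsep a b hba.symm)
      linarith
    calc ∑ a, ∑ b, F (ip a b) ≤ ∑ _a : ι, F 1 := Finset.sum_le_sum fun a _ => hrow a
      _ = (Fintype.card ι : ℝ) * F 1 := by
        simp only [Finset.sum_const, Finset.card_univ, nsmul_eq_mul]
  -- combine
  have hF1 : 0 ≤ F 1 :=
    Finset.sum_nonneg fun k _ => mul_nonneg (hf k) (gegenbauerSum_one_pos hμ k).le
  rcases (Nat.cast_nonneg (Fintype.card ι) : (0 : ℝ) ≤ _).eq_or_lt with h0 | hpos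
  · rw [← h0, zero_mul]; exact hF1
  · have h := hlow.trans hupp
    have h' : (Fintype.card ι : ℝ) * ((Fintype.card ι : ℝ) * f 0) ≤
        (Fintype.card ι : ℝ) * F 1 := by
      rw [← mul_assoc, ← sq]; exact h
    exact le_of_mul_le_mul_left h' hpos

/-- **The linear programming bound for spherical codes** (`Finset` form). If `n = 2μ + 2` with
`μ > 0` (i.e. `n ≥ 3`, `μ = (n-2)/2`), `f_k ≥ 0` for `k ≤ d`, and
`Σ_{k ≤ d} f_k C_k^{μ}(t) ≤ 0` for `-1 ≤ t ≤ s`, then every finite set `C` of unit vectors of `ℝⁿ`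
with pairwise inner products `≤ s` satisfies `|C| · f_0 ≤ Σ_k f_k C_k^{μ}(1)`.
[cite: Boumova2002, Thm. 2.3.2 (LPB for spherical codes; DGS 1977, KL 1978)] -/
theorem card_mul_le (hn : (n : ℝ) = 2 * μ + 2) (hμ : 0 < μ)
    (d : ℕ) (f : ℕ → ℝ) (hf : ∀ k, 0 ≤ f k) (s : ℝ)
    (hF : ∀ t : ℝ, -1 ≤ t → t ≤ s → ∑ k ∈ range (d + 1), f k * gegenbauerSum μ k t ≤ 0)
    (C : Finset (EuclideanSpace ℝ (Fin n))) (h1 : ∀ x ∈ C, ‖x‖ = 1)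
    (h2 : ∀ x ∈ C, ∀ y ∈ C, x ≠ y → inner ℝ x y ≤ s) :
    (C.card : ℝ) * f 0 ≤ ∑ k ∈ range (d + 1), f k * gegenbauerSum μ k 1 := by
  classical
  have key := card_mul_le_coord hn hμ d f hf s hF (ι := C)
    (fun a j => (a : EuclideanSpace ℝ (Fin n)) j) ?_ ?_
  · simpa [Fintype.card_coe] using key
  · intro a
    rw [← EuclideanSpace.real_norm_sq_eq, h1 a a.2, one_pow]
  · intro a b hab
    have hne : (a : EuclideanSpace ℝ (Fin n)) ≠ b := fun h => hab (Subtype.ext h)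
    have h := h2 a a.2 b b.2 hne
    have hinner : inner ℝ (a : EuclideanSpace ℝ (Fin n)) (b : EuclideanSpace ℝ (Fin n)) =
        ∑ j, (a : EuclideanSpace ℝ (Fin n)) j * (b : EuclideanSpace ℝ (Fin n)) j := by
      simp [PiLp.inner_apply, mul_comm]
    rw [hinner] at h
    exact h

/-- **Integer form of the linear programming bound**: under the hypotheses of `card_mul_le`,
if moreover `f_0 > 0` and `Σ_k f_k C_k^{μ}(1) < (N + 1) f_0`, then `|C| ≤ N`; in particular
`A(n, s) ≤ N`, and for `s = 1/2` the kissing number of dimension `n` is at most `N`.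
[cite: Boumova2002, Thm. 2.3.2 (LPB for spherical codes; DGS 1977, KL 1978)] -/
theorem card_le (hn : (n : ℝ) = 2 * μ + 2) (hμ : 0 < μ)
    (d : ℕ) (f : ℕ → ℝ) (hf : ∀ k, 0 ≤ f k) (s : ℝ)
    (hF : ∀ t : ℝ, -1 ≤ t → t ≤ s → ∑ k ∈ range (d + 1), f k * gegenbauerSum μ k t ≤ 0)
    (N : ℕ) (hf0 : 0 < f 0)
    (hN : ∑ k ∈ range (d + 1), f k * gegenbauerSum μ k 1 < ((N : ℝ) + 1) * f 0)
    (C : Finset (EuclideanSpace ℝ (Fin n))) (h1 : ∀ x ∈ C, ‖x‖ = 1)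
    (h2 : ∀ x ∈ C, ∀ y ∈ C, x ≠ y → inner ℝ x y ≤ s) :
    C.card ≤ N := by
  have h := card_mul_le hn hμ d f hf s hF C h1 h2
  have hlt : (C.card : ℝ) < (N : ℝ) + 1 := by
    by_contra hc
    have hc' : (N : ℝ) + 1 ≤ (C.card : ℝ) := not_lt.mp hc
    have : ((N : ℝ) + 1) * f 0 ≤ (C.card : ℝ) * f 0 := mul_le_mul_of_nonneg_right hc' hf0.le
    linarith
  have hlt' : C.card < N + 1 := by exact_mod_cast hlt
  omega

/-! ### The case of equality (Bannai–Sloane): inner products of an LP-sharp code are roots of `f` -/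

/-- **Complementary slackness, coordinate form.** Under the hypotheses of `card_mul_le_coord`, if
the bound is attained, `(#points) · f_0 = f(1)`, then `f` vanishes at every inner product of two
distinct points: `Σ_k f_k C_k^{μ}(⟨x_a, x_b⟩) = 0` for `a ≠ b` (all the inequalities in the proof
of the bound are equalities). This is the first step of Bannai–Sloane's uniqueness argument for the
`240`- and `196560`-point kissing configurations. [cite: ConwaySloane1999, Ch. 14 §§2–3 (Bannai–Sloane uniqueness proofs, first step)] -/
theorem sum_eq_zero_of_card_mul_eq_coord (hn : (n : ℝ) = 2 * μ + 2) (hμ : 0 < μ)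
    (d : ℕ) (f : ℕ → ℝ) (hf : ∀ k, 0 ≤ f k) (s : ℝ)
    (hF : ∀ t : ℝ, -1 ≤ t → t ≤ s → ∑ k ∈ range (d + 1), f k * gegenbauerSum μ k t ≤ 0)
    {ι : Type*} [Fintype ι] (x : ι → Fin n → ℝ)
    (hunit : ∀ a, ∑ j, x a j ^ 2 = 1) (hsep : ∀ a b, a ≠ b → ∑ j, x a j * x b j ≤ s)
    (heq : (Fintype.card ι : ℝ) * f 0 = ∑ k ∈ range (d + 1), f k * gegenbauerSum μ k 1)
    {a b : ι} (hab : a ≠ b) :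
    ∑ k ∈ range (d + 1), f k * gegenbauerSum μ k (∑ j, x a j * x b j) = 0 := by
  classical
  set F : ℝ → ℝ := fun t => ∑ k ∈ range (d + 1), f k * gegenbauerSum μ k t with hFdef
  set ip : ι → ι → ℝ := fun a b => ∑ j, x a j * x b j with hip
  have hdiag : ∀ a, ip a a = 1 := fun a => by
    simp only [hip, ← sq]; exact hunit a
  have hoffnp : ∀ a b, a ≠ b → F (ip a b) ≤ 0 := fun a b h =>
    hF _ (neg_one_le_dot _ _ (hunit a) (hunit b)) (hsep a b h)
  -- the three (in)equalities of the bound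
  have hlow : (Fintype.card ι : ℝ) ^ 2 * f 0 ≤ ∑ a, ∑ b, F (ip a b) := by
    have hswap : ∑ a, ∑ b, F (ip a b) =
        ∑ k ∈ range (d + 1), f k * ∑ a, ∑ b, gegenbauerSum μ k (ip a b) := by
      have h1 : ∀ a, ∑ b, F (ip a b) =
          ∑ k ∈ range (d + 1), ∑ b, f k * gegenbauerSum μ k (ip a b) := fun a => by
        simp only [hFdef]; exact Finset.sum_comm
      rw [Finset.sum_congr rfl fun a _ => h1 a, Finset.sum_comm]
      refine Finset.sum_congr rfl fun k _ => ?_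
      rw [Finset.mul_sum]
      exact Finset.sum_congr rfl fun a _ => by rw [Finset.mul_sum]
    rw [hswap]
    have hterm : ∀ k ∈ range (d + 1), 0 ≤ f k * ∑ a, ∑ b, gegenbauerSum μ k (ip a b) :=
      fun k _ => mul_nonneg (hf k) (sum_sum_gegenbauerSum_nonneg hn hμ k x hunit)
    have h0 : f 0 * ∑ a, ∑ b, gegenbauerSum μ 0 (ip a b) = (Fintype.card ι : ℝ) ^ 2 * f 0 := by
      simp only [gegenbauerSum_zero, Finset.sum_const, Finset.card_univ, nsmul_eq_mul]
      ring
    rw [← h0]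
    exact Finset.single_le_sum hterm (Finset.mem_range.2 (Nat.succ_pos d))
  have hrow : ∀ a, ∑ b, F (ip a b) = F 1 + ∑ b ∈ univ.erase a, F (ip a b) := fun a => by
    rw [← Finset.add_sum_erase _ _ (Finset.mem_univ a), hdiag]
  have hrowle : ∀ a, ∑ b ∈ univ.erase a, F (ip a b) ≤ 0 := fun a =>
    Finset.sum_nonpos fun b hb => hoffnp a b (Finset.ne_of_mem_erase hb).symm
  have hupp : ∑ a, ∑ b, F (ip a b) = (Fintype.card ι : ℝ) * F 1 + ∑ a, ∑ b ∈ univ.erase a, F (ip a b) := by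
    rw [Finset.sum_congr rfl fun a _ => hrow a, Finset.sum_add_distrib]
    simp only [Finset.sum_const, Finset.card_univ, nsmul_eq_mul]
  -- with equality, the total off-diagonal sum is `0`
  have htot : ∑ a, ∑ b ∈ univ.erase a, F (ip a b) = 0 := by
    have hle : ∑ a, ∑ b ∈ univ.erase a, F (ip a b) ≤ 0 := Finset.sum_nonpos fun a _ => hrowle a
    have hge : 0 ≤ ∑ a, ∑ b ∈ univ.erase a, F (ip a b) := by
      have h1 : (Fintype.card ι : ℝ) ^ 2 * f 0 = (Fintype.card ι : ℝ) * F 1 := by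
        rw [sq, mul_assoc, heq]
      linarith [hlow, hupp]
    linarith
  -- every row, and then every term, vanishes
  have hrow0 : ∑ b ∈ univ.erase a, F (ip a b) = 0 := by
    have := (Finset.sum_eq_zero_iff_of_nonpos fun a _ => hrowle a).1 htot
    exact this a (Finset.mem_univ a)
  have hterm0 := (Finset.sum_eq_zero_iff_of_nonpos fun b hb =>
    hoffnp a b (Finset.ne_of_mem_erase hb).symm).1 hrow0
  exact hterm0 b (Finset.mem_erase.2 ⟨hab.symm, Finset.mem_univ b⟩)

/-- **Complementary slackness for spherical codes** (`Finset` form): if a code `C ⊂ S^{n-1}` with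
pairwise inner products `≤ s` attains the linear programming bound, `|C| · f_0 = f(1)`, then
`f(⟨x, y⟩) = Σ_k f_k C_k^{μ}(⟨x,y⟩) = 0` for all distinct `x, y ∈ C` — the inner products of the
code lie among the roots of `f` in `[-1, s]` (Bannai–Sloane 1981, first step of the uniqueness of the
`E₈` and Leech kissing configurations). [cite: ConwaySloane1999, Ch. 14 §§2–3 (Bannai–Sloane uniqueness proofs, first step)] -/
theorem sum_eq_zero_of_card_mul_eq (hn : (n : ℝ) = 2 * μ + 2) (hμ : 0 < μ)
    (d : ℕ) (f : ℕ → ℝ) (hf : ∀ k, 0 ≤ f k) (s : ℝ)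
    (hF : ∀ t : ℝ, -1 ≤ t → t ≤ s → ∑ k ∈ range (d + 1), f k * gegenbauerSum μ k t ≤ 0)
    (C : Finset (EuclideanSpace ℝ (Fin n))) (h1 : ∀ x ∈ C, ‖x‖ = 1)
    (h2 : ∀ x ∈ C, ∀ y ∈ C, x ≠ y → inner ℝ x y ≤ s)
    (heq : (C.card : ℝ) * f 0 = ∑ k ∈ range (d + 1), f k * gegenbauerSum μ k 1)
    {x y : EuclideanSpace ℝ (Fin n)} (hx : x ∈ C) (hy : y ∈ C) (hxy : x ≠ y) :
    ∑ k ∈ range (d + 1), f k * gegenbauerSum μ k (inner ℝ x y) = 0 := by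
  classical
  have hinner : ∀ a b : EuclideanSpace ℝ (Fin n), inner ℝ a b = ∑ j, a j * b j := fun a b => by
    simp [PiLp.inner_apply, mul_comm]
  have key := sum_eq_zero_of_card_mul_eq_coord hn hμ d f hf s hF (ι := C)
    (fun a j => (a : EuclideanSpace ℝ (Fin n)) j) ?_ ?_ ?_ (a := ⟨x, hx⟩) (b := ⟨y, hy⟩)
    (fun h => hxy (congrArg Subtype.val h))
  · simpa [hinner] using key
  · intro a
    rw [← EuclideanSpace.real_norm_sq_eq, h1 a a.2, one_pow]
  · intro a b hab
    have hne : (a : EuclideanSpace ℝ (Fin n)) ≠ b := fun h => hab (Subtype.ext h)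
    have h := h2 a a.2 b b.2 hne
    rwa [hinner] at h
  · simpa [Fintype.card_coe] using heq

/-- **Complementary slackness, design half (coordinate form).** If the bound is attained,
`(#points) · f_0 = f(1)`, then for every `k ≥ 1` with `f_k > 0` the degree-`k` Gegenbauer sum
over the configuration vanishes, `Σ_{a,b} C_k^{μ}(⟨x_a, x_b⟩) = 0` (the moment conditions making an
LP-sharp code a spherical design; Bannai–Sloane 1981). [cite: ConwaySloane1999, Ch. 14 §§2–3 (Bannai–Sloane uniqueness proofs, first step)] -/
theorem sum_sum_gegenbauerSum_eq_zero_of_card_mul_eq_coord (hn : (n : ℝ) = 2 * μ + 2) (hμ : 0 < μ)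
    (d : ℕ) (f : ℕ → ℝ) (hf : ∀ k, 0 ≤ f k) (s : ℝ)
    (hF : ∀ t : ℝ, -1 ≤ t → t ≤ s → ∑ k ∈ range (d + 1), f k * gegenbauerSum μ k t ≤ 0)
    {ι : Type*} [Fintype ι] (x : ι → Fin n → ℝ)
    (hunit : ∀ a, ∑ j, x a j ^ 2 = 1) (hsep : ∀ a b, a ≠ b → ∑ j, x a j * x b j ≤ s)
    (heq : (Fintype.card ι : ℝ) * f 0 = ∑ k ∈ range (d + 1), f k * gegenbauerSum μ k 1)
    {k : ℕ} (hk : k ∈ range (d + 1)) (hk1 : 1 ≤ k) (hfk : 0 < f k) :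
    ∑ a, ∑ b, gegenbauerSum μ k (∑ j, x a j * x b j) = 0 := by
  classical
  set F : ℝ → ℝ := fun t => ∑ k ∈ range (d + 1), f k * gegenbauerSum μ k t with hFdef
  set ip : ι → ι → ℝ := fun a b => ∑ j, x a j * x b j with hip
  have hdiag : ∀ a, ip a a = 1 := fun a => by
    simp only [hip, ← sq]; exact hunit a
  have hoffnp : ∀ a b, a ≠ b → F (ip a b) ≤ 0 := fun a b h =>
    hF _ (neg_one_le_dot _ _ (hunit a) (hunit b)) (hsep a b h)
  set T : ℕ → ℝ := fun k => ∑ a, ∑ b, gegenbauerSum μ k (ip a b) with hT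
  have hTnn : ∀ k, 0 ≤ T k := fun k => sum_sum_gegenbauerSum_nonneg hn hμ k x hunit
  have hswap : ∑ a, ∑ b, F (ip a b) = ∑ k ∈ range (d + 1), f k * T k := by
    have h1 : ∀ a, ∑ b, F (ip a b) =
        ∑ k ∈ range (d + 1), ∑ b, f k * gegenbauerSum μ k (ip a b) := fun a => by
      simp only [hFdef]; exact Finset.sum_comm
    rw [Finset.sum_congr rfl fun a _ => h1 a, Finset.sum_comm]
    refine Finset.sum_congr rfl fun k _ => ?_
    rw [hT, Finset.mul_sum]
    exact Finset.sum_congr rfl fun a _ => by rw [Finset.mul_sum]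
  have hT0 : f 0 * T 0 = (Fintype.card ι : ℝ) ^ 2 * f 0 := by
    simp only [hT, gegenbauerSum_zero, Finset.sum_const, Finset.card_univ, nsmul_eq_mul]
    ring
  -- upper bound with the diagonal split off
  have hupp : ∑ a, ∑ b, F (ip a b) ≤ (Fintype.card ι : ℝ) * F 1 := by
    have hrow : ∀ a, ∑ b, F (ip a b) ≤ F 1 := fun a => by
      rw [← Finset.add_sum_erase _ _ (Finset.mem_univ a), hdiag]
      have hoff : ∑ b ∈ univ.erase a, F (ip a b) ≤ 0 :=
        Finset.sum_nonpos fun b hb => hoffnp a b (Finset.ne_of_mem_erase hb).symm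
      linarith
    calc ∑ a, ∑ b, F (ip a b) ≤ ∑ _a : ι, F 1 := Finset.sum_le_sum fun a _ => hrow a
      _ = (Fintype.card ι : ℝ) * F 1 := by
        simp only [Finset.sum_const, Finset.card_univ, nsmul_eq_mul]
  -- the `k ≥ 1` part of the expansion is `≤ 0`, termwise `≥ 0`
  have hsplit : ∑ k ∈ range (d + 1), f k * T k =
      f 0 * T 0 + ∑ k ∈ (range (d + 1)).erase 0, f k * T k :=
    (Finset.add_sum_erase _ _ (Finset.mem_range.2 (Nat.succ_pos d))).symm
  have hrest : ∑ k ∈ (range (d + 1)).erase 0, f k * T k = 0 := by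
    have hle : ∑ k ∈ (range (d + 1)).erase 0, f k * T k ≤ 0 := by
      have h1 : (Fintype.card ι : ℝ) * F 1 = (Fintype.card ι : ℝ) ^ 2 * f 0 := by
        rw [sq, mul_assoc, heq]
      linarith [hupp, hswap, hsplit, hT0]
    have hge : 0 ≤ ∑ k ∈ (range (d + 1)).erase 0, f k * T k :=
      Finset.sum_nonneg fun k _ => mul_nonneg (hf k) (hTnn k)
    linarith
  have hterm := (Finset.sum_eq_zero_iff_of_nonneg fun k _ => mul_nonneg (hf k) (hTnn k)).1 hrest k
    (Finset.mem_erase.2 ⟨by omega, hk⟩)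
  rcases mul_eq_zero.1 hterm with h | h
  · exact absurd h hfk.ne'
  · exact h

end DelsarteLP

end Literature.Geometry.DiscreteGeometry

end
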